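import Summits.QuantumFields.BalabanUV.T4Continuum.Spine.NE1p.DressedSmallFieldDepCoresWitness

/-!
# T⁴ programme, spine estimate NE1′ (node O3b/H2) — WITNESS «THE TERM-DEPENDENT POLYMER FAMILY IS INHABITED», PART 2: the GENUINE records —
# both terms of the dependent family READ the live table, and the attached part AND the μ-part bounded by N0r §2's ENDs (PART 1
# `depCoresEnd_fires` ∕ `depCoresMuEnd_fires`) are NOT zero

Cell `pub-balaban`, sub-cell `t4`, row NE1′ formalisation crew (`t4/formal/NE1p/LEAVES.md` row W41 ∕ DAG N29zy; INTENT HOME/CLAIMS.log l.18111,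
BOOKED typer R-T120 (ii), STAGED l.18331), unit
`b2b-balaban-t4-ne1p-formalise-leaf-09` (gen 11).  ADDITIVE — imports PART 1 `Spine/NE1p/DressedSmallFieldDepCoresWitness` ONLY (→ N0r, W35 →
W33 → W24); THEOREMS ONLY (0 def, 0 `def … : Prop`, 0 cite, 0 sorry); nothing of PART 1 ∕ N0r ∕ N0q ∕ N0p ∕ W33 ∕ W35 ∕ W24 ∕ row NE5 is
restated — W33's `incr`, `integrable_term`, `integral_incr_pos`, `norm_cexp_readOut_le`, `gaussian_E1`, `integrable_gauss_E1`, W35's `cM`∕`cM_pos`,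
W24's `exp_locE_cube`∕`dressedConst_le_one`, PART 1's `coreV`∕`chi_coreV`∕`readOut_coreV_smul_liveTable`∕`GD`∕`termsD_X₀`∕`actD`∕`budget_half` BY NAME.
* §5 `termAt_coreW_pencil` ∕ `termAt_coreV_pencil` — the two cores' terms along the pencil in CLOSED FORM (Dirac mass out, `chi = 1`, `N = 1`,
  the read-out EVALUATED: `c·∫ e^{s·x·e^{−(v 0)²}}·e^{−‖v‖²} dv` at `x = r` resp. `x = 2r` — the two-label core reads the table twice);
  `actD_real_sub_zero`: the increment at a real source `t` is `cM(2r)∕2·∫ incr (t·2r) + cM r∕2·∫ incr (t·r)` — one REAL integral per term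
  (W33's increment density BY NAME); **`actD_mu_live`** ∕ **`actD_live`**: it is NOT zero (each term contributes a positive number);
  `norm_actD_X₀_lt_one` (`‖act s X₀‖ ≤ A·√π∕√(2π) < 1` for `‖s‖ ≤ 2`); **`depCoresMuEnd_live`** ∕ **`depCoresEnd_live`**: the bounded
  quantities of PART 1's two END applications are NOT zero (W24's `exp_locE_cube` BY NAME turns equal outputs into equal activities).

WORDING OF RECORD (crew row W41 = DAG N29zy, typer R-T120 (ii): the holder's sentence + rider ADOPTED verbatim; the code spells `𝒴D`∕`𝔊D`
as `YD`∕`GD`): «OUR decided two-term datum over row NE5's toy frame; the dependent type family `𝒴D`∕`domD` is OURS — it shows N0r's dependent-`dom`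
generality is inhabited and that N0q's constant-`dom` END cannot even state this activity, nothing about Bałaban's polymer-indexed (2.14) data
((B1b) NOT claimed); (B3)'s clause is MET because the weights are CHOSEN to split W24's located constant — (B3) UNPRINTED (G-ne9p2-5, shared with
NE9); toy arithmetic only, no numeral of [Balaban1988RGII]; 0 binders instantiated on Bałaban's densities; wall v1.7 (T4-DAG v43) does NOT move».

HONEST FRAMING — as PART 1.  A DECIDED TOY ([folklore]; 0 sorry; 0 citations; no `def … : Prop`).  The cores are instances of the cell's
typed FORMAT of (2.14) over row NE5's TOY frame with NE5's decoupled toy letters — NOT Bałaban's (2.14) terms, NOT rows NE2∕NE3's Gaussian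
data, NOT the substrate's slot; `√π`, `√(2π)`, `e^{−2x}` are OUR toy arithmetic (Mathlib's Gaussian integral) — no numeral of
[Balaban1988RGII]; (B3) = GAPS G-ne9p2-5 stays UNPRINTED for Bałaban's cores; 0 binders instantiated on Bałaban's densities; no wall item;
wall v1.7 (T4-DAG v43) does NOT move; R-t4r2-Q2 NOT met thereby; NE1′ ⇐ the named binders — NOT proved, NOT printed; spine PROVED 0∕9;
count 9 unchanged.  Rung (B)+1 on ONE finite four-torus — NOT infinite volume, NOT a mass gap, NOT OS on ℝ⁴, NOT Clay.  HONEST DEPENDENCY: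
continuum YM on T⁴ ⇐ BetaPertH ∧ nine spine estimates (0/9 proved); BetaPertH ⇐ (D1) ∧ (D4) ∧ CAP+tail; G-an2-4 gates asym, D1 and NE2/3/4.
-/

noncomputable section

namespace Summit.QuantumFields.BalabanUV.T4Continuum.NE1p.DressedSmallFieldDepCoresWitness

open Set Metric MeasureTheory Complex
open scoped BigOperators
open Literature.MathematicalPhysics.QuantumFieldTheory.Balaban1983to89
open Literature.MathematicalPhysics.QuantumFieldTheory.Balaban1983to89.B13Resummation (locE)
open Literature.MathematicalPhysics.QuantumFieldTheory.Balaban1983to89.TreeLengthTorus (TDom tsys)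
open Literature.MathematicalPhysics.QuantumFieldTheory.Balaban1983to89.TreeLengthTorusGeometry (tgeometry TTouch)
open Summit.QuantumFields.BalabanUV.T4Continuum.B13HistMeasurable (B13HistM)
open Summit.QuantumFields.BalabanUV.T4Continuum.B13HistWitness (toyFrame)
open Summit.QuantumFields.BalabanUV.T4Continuum.B13TermParamGaussianBi (BiCore)
open Summit.QuantumFields.BalabanUV.T4Continuum.NE1p.DressedSmallFieldTorusWitness (X₀ dressedConst_le_one exp_locE_cube)
open Summit.QuantumFields.BalabanUV.T4Continuum.NE1p.DressedSmallFieldCoresWitness (E1 crd liveTable coreW chi_coreW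
  readOut_coreW_smul_liveTable gaussian_E1 Acst Acst_pos incr integral_incr_pos integrable_gauss_E1 norm_cexp_readOut_le integrable_term)
open Summit.QuantumFields.BalabanUV.T4Continuum.NE1p.DressedSmallFieldCoresMassWitness (cM cM_pos)

variable (c r : ℝ) (hr : 0 ≤ r)

section Torus
variable (N : ℕ) [NeZero N]

/-! ## §5 GENUINE: both terms READ the table, and the attached part AND the μ-part of the activity are NOT zero -/

/-- **W33's CORE IN CLOSED FORM AT A GENERAL WEIGHT** [decided toy]: `(coreW c r).termAt 0 (0 + s•liveTable) = c·∫ e^{s·r·e^{−(v 0)²}}·e^{−‖v‖²} dv`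
(W33's `termBi_coreFam` computation, stated at the weight `c`; Dirac mass out, `chi = 1`, `N = 1`). [folklore] -/
theorem termAt_coreW_pencil (s : ℂ) :
    (coreW c r hr).termAt (0 : ℂ) ((0 : B13HistM toyFrame) + s • liveTable) =
      (c : ℂ) * ∫ v : E1, cexp (s * ((r : ℂ) * (Real.exp (-(crd v ^ 2)) : ℂ))) * cexp (-(((‖v‖ ^ 2 : ℝ) : ℂ))) := by
  rw [BiCore.termAt]
  show ∫ p, (coreW c r hr).w p * (coreW c r hr).N 0 p *
      ∫ v, (coreW c r hr).chi v * cexp ((coreW c r hr).readOut p v (0 + s • liveTable)) *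
        cexp (-(coreW c r hr).q 0 p v) ∂volume ∂(coreW c r hr).lam = _
  simp_rw [chi_coreW, zero_add, readOut_coreW_smul_liveTable, one_mul]
  show ∫ p, (c : ℂ) * 1 * ∫ v, cexp (s * ((r : ℂ) * (Real.exp (-(crd v ^ 2)) : ℂ))) *
      cexp (-(((‖v‖ ^ 2 : ℝ) : ℂ))) ∂volume ∂(Measure.dirac ()) = _
  rw [integral_dirac, mul_one]

/-- **THE TWO-LABEL CORE IN CLOSED FORM** [decided toy]: `(coreV c r).termAt 0 (0 + s•liveTable) = c·∫ e^{s·(2r)·e^{−(v 0)²}}·e^{−‖v‖²} dv` —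
W33's closed form at the DOUBLED contour radius `2r` (the two labels' read-outs add). [folklore] -/
theorem termAt_coreV_pencil (s : ℂ) :
    (coreV c r hr).termAt (0 : ℂ) ((0 : B13HistM toyFrame) + s • liveTable) =
      (c : ℂ) * ∫ v : E1, cexp (s * (((2 * r : ℝ) : ℂ) * (Real.exp (-(crd v ^ 2)) : ℂ))) * cexp (-(((‖v‖ ^ 2 : ℝ) : ℂ))) := by
  rw [BiCore.termAt]
  show ∫ p, (coreV c r hr).w p * (coreV c r hr).N 0 p *
      ∫ v, (coreV c r hr).chi v * cexp ((coreV c r hr).readOut p v (0 + s • liveTable)) *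
        cexp (-(coreV c r hr).q 0 p v) ∂volume ∂(coreV c r hr).lam = _
  simp_rw [chi_coreV, zero_add, readOut_coreV_smul_liveTable, one_mul]
  show ∫ p, (c : ℂ) * 1 * ∫ v, cexp (s * (((2 * r : ℝ) : ℂ) * (Real.exp (-(crd v ^ 2)) : ℂ))) *
      cexp (-(((‖v‖ ^ 2 : ℝ) : ℂ))) ∂volume ∂(Measure.dirac ()) = _
  rw [integral_dirac, mul_one]

/-- The increment of a closed-form term between the real source `t` and `0`: `c·∫ incr (t·x)` (W33's increment density BY NAME). [folklore] -/
theorem closedForm_real_sub_zero (x : ℝ) (hx : 0 ≤ x) (t : ℝ) :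
    (c : ℂ) * (∫ v : E1, cexp ((t : ℂ) * ((x : ℂ) * (Real.exp (-(crd v ^ 2)) : ℂ))) * cexp (-(((‖v‖ ^ 2 : ℝ) : ℂ)))) -
        (c : ℂ) * (∫ v : E1, cexp ((0 : ℂ) * ((x : ℂ) * (Real.exp (-(crd v ^ 2)) : ℂ))) * cexp (-(((‖v‖ ^ 2 : ℝ) : ℂ)))) =
      (c : ℂ) * ((∫ v, incr (t * x) v : ℝ) : ℂ) := by
  rw [← mul_sub, ← integral_sub (integrable_term x hx (t : ℂ)) (integrable_term x hx 0), ← integral_complex_ofReal]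
  congr 1
  refine integral_congr_ae (Filter.Eventually.of_forall fun v => ?_)
  simp only [incr, zero_mul, Complex.exp_zero]
  push_cast
  ring_nf

/-- **THE INCREMENT AT A REAL SOURCE `t` IN CLOSED FORM** [decided toy]: `act t X₀ − act 0 X₀ = cM(2r)∕2·∫ incr (t·2r) + cM r∕2·∫ incr (t·r)` —
one REAL integral per term. [folklore] -/
theorem actD_real_sub_zero (k : ℕ) (t : ℝ) :
    actD r hr N k (t : ℂ) (X₀ N) - actD r hr N k 0 (X₀ N) =
      ((cM (2 * r) / 2 * (∫ v, incr (t * (2 * r)) v) + cM r / 2 * (∫ v, incr (t * r) v) : ℝ) : ℂ) := by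
  unfold actD
  rw [termsD_X₀, Fintype.sum_bool, Fintype.sum_bool]
  simp only [GD_true, GD_false]
  rw [termAt_coreV_pencil, termAt_coreV_pencil, termAt_coreW_pencil, termAt_coreW_pencil, add_sub_add_comm,
    closedForm_real_sub_zero _ (2 * r) (by positivity) t, closedForm_real_sub_zero _ r hr t]
  push_cast
  ring

/-- **THE μ-PART AT A REAL POSITIVE SOURCE IS NOT ZERO** [decided toy]: both terms contribute a POSITIVE real number (`cM x∕2 > 0`,
`∫ incr (t·x) > 0` for `0 < t`, `0 < x` — W33's `integral_incr_pos`). [folklore] -/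
theorem actD_mu_live (hr0 : 0 < r) {t : ℝ} (ht : 0 < t) (k : ℕ) : actD r hr N k (t : ℂ) (X₀ N) ≠ actD r hr N k 0 (X₀ N) := by
  intro h
  have h0 := sub_eq_zero.2 h
  rw [actD_real_sub_zero] at h0
  have hre := Complex.ofReal_eq_zero.1 h0
  have h1 : 0 < cM (2 * r) / 2 * ∫ v, incr (t * (2 * r)) v :=
    mul_pos (half_pos (cM_pos _)) (integral_incr_pos _ (by positivity))
  have h2 : 0 < cM r / 2 * ∫ v, incr (t * r) v := mul_pos (half_pos (cM_pos _)) (integral_incr_pos _ (mul_pos ht hr0))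
  linarith

/-- **THE ATTACHED PART IS NOT ZERO** — the source `t = 1`. [folklore] -/
theorem actD_live (hr0 : 0 < r) (k : ℕ) : actD r hr N k 1 (X₀ N) ≠ actD r hr N k 0 (X₀ N) := by
  simpa using actD_mu_live r hr N hr0 one_pos k

/-- One closed-form term is SMALL along the pencil: `(cM x∕2)·‖∫ e^{s·x·e^{−φ²}}·e^{−‖v‖²}‖ ≤ (cM x∕2)·e^{‖s‖x}·√π ≤ (A∕2)·(√π∕√(2π))` for `‖s‖ ≤ 2`
(W33's `norm_cexp_readOut_le` ∕ `gaussian_E1` BY NAME, `budget_half`). [folklore] -/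
theorem norm_term_le (x : ℝ) (hx : 0 ≤ x) {s : ℂ} (hs : ‖s‖ ≤ 2) :
    ‖((cM x / 2 : ℝ) : ℂ) * ∫ v : E1, cexp (s * ((x : ℂ) * (Real.exp (-(crd v ^ 2)) : ℂ))) * cexp (-(((‖v‖ ^ 2 : ℝ) : ℂ)))‖ ≤
      Acst / 2 * (Real.sqrt Real.pi / Real.sqrt (2 * Real.pi)) := by
  rw [norm_mul, Complex.norm_real, Real.norm_eq_abs]
  have hb : ∀ v : E1, ‖cexp (s * ((x : ℂ) * (Real.exp (-(crd v ^ 2)) : ℂ))) * cexp (-(((‖v‖ ^ 2 : ℝ) : ℂ)))‖ ≤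
      Real.exp (‖s‖ * x) * Real.exp (-‖v‖ ^ 2) := fun v => by
    rw [norm_mul, ← Complex.ofReal_neg, Complex.norm_exp_ofReal]
    exact mul_le_mul_of_nonneg_right (norm_cexp_readOut_le x hx s v) (Real.exp_pos _).le
  have hI := norm_integral_le_of_norm_le ((integrable_gauss_E1).const_mul (Real.exp (‖s‖ * x))) (Filter.Eventually.of_forall hb)
  rw [integral_const_mul, gaussian_E1] at hI
  have hπ : 0 < Real.sqrt Real.pi := Real.sqrt_pos.2 Real.pi_pos
  have h2π : 0 < Real.sqrt (2 * Real.pi) := Real.sqrt_pos.2 (by positivity)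
  have hgrow : |cM x / 2| * Real.sqrt (2 * Real.pi) * Real.exp (x * ‖s‖) ≤ Acst / 2 := budget_half x hx hs
  calc |cM x / 2| * ‖∫ v : E1, cexp (s * ((x : ℂ) * (Real.exp (-(crd v ^ 2)) : ℂ))) * cexp (-(((‖v‖ ^ 2 : ℝ) : ℂ)))‖
      ≤ |cM x / 2| * (Real.exp (‖s‖ * x) * Real.sqrt Real.pi) := by gcongr
    _ = |cM x / 2| * Real.sqrt (2 * Real.pi) * Real.exp (x * ‖s‖) * (Real.sqrt Real.pi / Real.sqrt (2 * Real.pi)) := by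
        rw [mul_comm ‖s‖ x]; field_simp
    _ ≤ Acst / 2 * (Real.sqrt Real.pi / Real.sqrt (2 * Real.pi)) :=
        mul_le_mul_of_nonneg_right hgrow (div_nonneg hπ.le h2π.le)

/-- The activities at `X₀` lie STRICTLY inside the unit disc for `‖s‖ ≤ 2` (`A ≤ 1` = W24's `dressedConst_le_one`, `√π < √(2π)`). [folklore] -/
theorem norm_actD_X₀_lt_one (k : ℕ) {s : ℂ} (hs : ‖s‖ ≤ 2) : ‖actD r hr N k s (X₀ N)‖ < 1 := by
  unfold actD
  rw [termsD_X₀, Fintype.sum_bool]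
  simp only [GD_true, GD_false]
  rw [termAt_coreV_pencil, termAt_coreW_pencil]
  have h2r : 0 ≤ 2 * r := by positivity
  have hπ : 0 < Real.sqrt Real.pi := Real.sqrt_pos.2 Real.pi_pos
  have hlt : Real.sqrt Real.pi < Real.sqrt (2 * Real.pi) := Real.sqrt_lt_sqrt Real.pi_pos.le (by linarith [Real.pi_pos])
  have hq : Real.sqrt Real.pi / Real.sqrt (2 * Real.pi) < 1 := (div_lt_one (hπ.trans hlt)).2 hlt
  have hA : Acst ≤ 1 := dressedConst_le_one
  refine (norm_add_le _ _).trans_lt ?_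
  calc ‖((cM (2 * r) / 2 : ℝ) : ℂ) * ∫ v : E1, cexp (s * (((2 * r : ℝ) : ℂ) * (Real.exp (-(crd v ^ 2)) : ℂ))) *
            cexp (-(((‖v‖ ^ 2 : ℝ) : ℂ)))‖ +
        ‖((cM r / 2 : ℝ) : ℂ) * ∫ v : E1, cexp (s * ((r : ℂ) * (Real.exp (-(crd v ^ 2)) : ℂ))) * cexp (-(((‖v‖ ^ 2 : ℝ) : ℂ)))‖
      ≤ Acst / 2 * (Real.sqrt Real.pi / Real.sqrt (2 * Real.pi)) + Acst / 2 * (Real.sqrt Real.pi / Real.sqrt (2 * Real.pi)) :=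
        add_le_add (norm_term_le (2 * r) h2r hs) (norm_term_le r hr hs)
    _ = Acst * (Real.sqrt Real.pi / Real.sqrt (2 * Real.pi)) := by ring
    _ < 1 := by
        have := Acst_pos
        nlinarith

open Classical in
/-- **THE μ-END's BOUNDED QUANTITY IS NOT ZERO** for a REAL source `0 < t ≤ 2` [decided toy]: equal dressed outputs on the cube would give
equal activities at `X₀` (W24's `exp_locE_cube` BY NAME), contradicting `actD_mu_live`. [folklore] -/
theorem depCoresMuEnd_live (hr0 : 0 < r) {t : ℝ} (ht : 0 < t) (ht2 : t ≤ 2) (k : ℕ) :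
    locE (tgeometry 4 N).ι (tgeometry 4 N).cubes (actD r hr N k (t : ℂ)) ((tgeometry 4 N).cubes (X₀ N)) ≠
      locE (tgeometry 4 N).ι (tgeometry 4 N).cubes (actD r hr N k 0) ((tgeometry 4 N).cubes (X₀ N)) := by
  intro h
  have ht' : ‖(t : ℂ)‖ ≤ 2 := by rw [Complex.norm_real, Real.norm_eq_abs, abs_of_pos ht]; exact ht2
  have h1 := exp_locE_cube N (w := actD r hr N k (t : ℂ)) (norm_actD_X₀_lt_one r hr N k ht')
  have h0 := exp_locE_cube N (w := actD r hr N k 0) (norm_actD_X₀_lt_one r hr N k (by simp))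
  have h' : cexp (locE (TTouch (d := 4) (N := N)) (fun Z : (tsys 4 N).Dom => Z.1) (actD r hr N k (t : ℂ)) {0}) =
      cexp (locE (TTouch (d := 4) (N := N)) (fun Z : (tsys 4 N).Dom => Z.1) (actD r hr N k 0) {0}) := congrArg cexp h
  rw [h1, h0, add_right_inj] at h'
  exact actD_mu_live r hr N hr0 ht k h'

open Classical in
/-- **THE END's BOUNDED QUANTITY IS NOT ZERO (attached part)** — the source `t = 1`. [folklore] -/
theorem depCoresEnd_live (hr0 : 0 < r) (k : ℕ) :
    locE (tgeometry 4 N).ι (tgeometry 4 N).cubes (actD r hr N k 1) ((tgeometry 4 N).cubes (X₀ N)) ≠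
      locE (tgeometry 4 N).ι (tgeometry 4 N).cubes (actD r hr N k 0) ((tgeometry 4 N).cubes (X₀ N)) := by
  simpa using depCoresMuEnd_live r hr N hr0 one_pos (by norm_num : (1 : ℝ) ≤ 2) k

end Torus

end Summit.QuantumFields.BalabanUV.T4Continuum.NE1p.DressedSmallFieldDepCoresWitness

end
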